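import Literature.IUT.HodgeTheaters.PiAvatarGlobalCuspLabels
import Literature.IUT.HodgeTheaters.PiAvatarGlobalLabelAction
import HarnessLib

/-!
# Coherence of the two label actions at the genuine `𝒟^{⊚±}`: on automorphisms induced by `Π_{C̲_K}`, the action of ALL of
# `Aut(𝒟^{⊚±})` (`gLabAutModel`, via `actF`) IS t1's action (`gLabAutOfPiCund`, via `CG.act`) (proof-only over p430475 + p430639)

S. Mochizuki, *Inter-universal Teichmüller theory I*, kurims manuscript (May 2020), Def 6.1 (v) p. 158 ([IUTchI] Def 6.1 (v) p.158)
[claim: Mochizuki2012, status: disputed] (D-0012 claim key, series status DISPUTED — kernel theorems over abc-iut-L5-t2's REAL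
`InitialThetaData` and abc-iut-L5-t1's `CuspGalois`, under the hypothesis binder `hS : D.CuspClassesNormaliserStable`; nothing of
the series is asserted, no side is taken on [IUTchIII] Cor. 3.12).

`mul_self_mem_PiXbar_of_mem_PiCbar` (`[Π_C̲ : Π_X̲] = 2` ⇒ squares of `Π_C̲` lie in `Π_X̲`), `gLabAutModel_autOfNormalizer_of_mem_PiCund`
(**`gLabAutModel (xΠ ↦ xcΠ) = gLabAutOfPiCund c`** for every `c ∈ Π_{C̲_K}` — the `autEquiv` inversion is invisible on
`Gal(X̲_K/C̲_K) ≅ ℤ/2`), and the chart reading **`gChart₀ (gLabAutModel ι x) = − gChart₀ x`** for the `±` involution `ι` induced by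
`c ∈ Π_{C̲_K} ∖ Π_{X̲_K}` (t13's (K2) in the ALL-of-`Aut` action).
-/

noncomputable section

namespace Literature.IUT.HodgeTheaters

open CategoryTheory

universe u v w

section GlobalLabelCoherence

variable {F : Type u} {K : Type v} {Fbar : Type w} [Field F] [NumberField F] [Field K] [NumberField K]
  [Algebra F K] [Field Fbar] [Algebra F Fbar] [Algebra K Fbar]
  {E : WeierstrassCurve F} [E.IsElliptic] {l : ℕ} {Pb : BadPlacePredicates K}
  (D : InitialThetaData F K Fbar E l Pb) (CG : D.geom.pe.CuspGalois) (hS : D.CuspClassesNormaliserStable)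

namespace InitialThetaData

/-- `[Π_C̲ : Π_X̲] = 2` ⇒ `c·c ∈ Π_X̲` for every `c ∈ Π_C̲` (t2's `ThetaGeometry.PiXbar_relIndex_PiCbar`).
([IUTchI] Def 3.1 (d) p.62) [claim: Mochizuki2012, status: disputed] -/
theorem mul_self_mem_PiXbar_of_mem_PiCbar {c : D.geom.pe.PiC} (hc : c ∈ D.geom.pe.PiCbar) :
    c * c ∈ D.geom.pe.PiXbar := by
  have h2 : (D.geom.pe.PiXbar.subgroupOf D.geom.pe.PiCbar).index = 2 := D.geom.PiXbar_relIndex_PiCbar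
  have key := (Subgroup.mul_mem_iff_of_index_two h2 (a := ⟨c, hc⟩) (b := ⟨c, hc⟩)).2 Iff.rfl
  rw [Subgroup.mem_subgroupOf] at key
  exact key

/-- **Coherence**: for `c ∈ Π_{C̲_K}` the ALL-of-`Aut` label action of `xΠ ↦ xcΠ` is t1's `CG.act` at the preimage, i.e.
`gLabAutModel (aut c) = gLabAutOfPiCund c`. ([IUTchI] Def 6.1 (v) p.158) [claim: Mochizuki2012, status: disputed] -/
theorem gLabAutModel_autOfNormalizer_of_mem_PiCund (c : D.PiC) (hc : c ∈ D.PiCund)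
    (hn : c ∈ Subgroup.normalizer ((D.PiXund : Subgroup D.PiC) : Set D.PiC)) :
    D.gLabAutModel CG hS (OrbitCat.autOfNormalizer c hn) = D.gLabAutOfPiCund CG c hc := by
  have hc' := D.preimOfPiCund_mem c hc
  have hn' : D.geom.embK (D.preimOfPiCund c hc) ∈ Subgroup.normalizer ((D.PiXund : Subgroup D.PiC) : Set D.PiC) := by
    rw [D.embK_preimOfPiCund c hc]
    exact hn
  have haut : OrbitCat.autOfNormalizer c hn = OrbitCat.autOfNormalizer (D.geom.embK (D.preimOfPiCund c hc)) hn' := by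
    rw [OrbitCat.autOfNormalizer_eq_iff, D.embK_preimOfPiCund c hc, inv_mul_cancel]
    exact D.PiXund.one_mem
  rw [haut, D.gLabAutModel_autOfNormalizer_embK_of_mul_self_mem CG hS _ hn' (D.mul_self_mem_PiXbar_of_mem_PiCbar hc'),
    gLabAutOfPiCund]

/-- The `Π_{C̲_K}`-induced automorphisms fix the zero label `ε⁰` (ALL-of-`Aut` action). ([IUTchI] Def 6.1 (v) p.158) [claim: Mochizuki2012, status: disputed] -/
theorem gLabAutModel_ε0_of_mem_PiCund (c : D.PiC) (hc : c ∈ D.PiCund)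
    (hn : c ∈ Subgroup.normalizer ((D.PiXund : Subgroup D.PiC) : Set D.PiC)) :
    D.gLabAutModel CG hS (OrbitCat.autOfNormalizer c hn) D.geom.pe.ε0 = D.geom.pe.ε0 := by
  rw [D.gLabAutModel_autOfNormalizer_of_mem_PiCund CG hS c hc hn]
  exact D.gLabAutOfPiCund_ε0 CG c hc

variable [Fact l.Prime]

/-- **(K2) in the ALL-of-`Aut` action**: the `±` involution `ι` (induced by `c ∈ Π_{C̲_K} ∖ Π_{X̲_K}`) reads `z ↦ −z` in the
chart based at `ε⁰`: `gChart₀ (gLabAutModel ι x) = − gChart₀ x`. ([IUTchI] Def 6.1 (v) p.158) [claim: Mochizuki2012, status: disputed] -/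
theorem gChart₀Model_gLabAutModel_of_not_mem_PiXund (c : D.PiC) (hc : c ∈ D.PiCund) (hcX : c ∉ D.PiXund)
    (hn : c ∈ Subgroup.normalizer ((D.PiXund : Subgroup D.PiC) : Set D.PiC)) (x : D.geom.pe.Cusp) :
    D.gChart₀Model CG (D.gLabAutModel CG hS (OrbitCat.autOfNormalizer c hn) x) = - D.gChart₀Model CG x := by
  rw [D.gLabAutModel_autOfNormalizer_of_mem_PiCund CG hS c hc hn]
  exact D.gChart₀Model_gLabAut_of_not_mem_PiXund CG c hc hcX x

end InitialThetaData

end GlobalLabelCoherence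

end Literature.IUT.HodgeTheaters
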